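import Literature.NumberTheory.ComplexMultiplication.PrimePowerBlockTranslatesSpan
import Literature.NumberTheory.ComplexMultiplication.ReflexDegreeQuadraticSubfieldBound
import Mathlib.GroupTheory.GroupAction.SubMulAction.OfStabilizer
import HarnessLib

/-!
# CM fields `K ⊇ k` (imaginary quadratic) of relative degree a PRIME POWER `[K : k] = p^j`: a CM type whose weight
# over `k` is prime to `p` is NONDEGENERATE (Dodson 1987 Prop. 4.1 for `n = 9`, in prime-power form)

COR-CM (cell `pub-hodgecm2`), literature seat `lit-deligne-3` (gen 11, claim PRIME-POWER-WEIGHT), count-neutral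
own lane; NEW AS STATED for general `p^j` (the printed anchor is the case `n = 9`, `K/ℚ` abelian), hence under
`Summits/`.  KERNEL ONLY: theorems; no definition, no named fact, no `sorry`.

B. Dodson, *On the Mumford–Tate group of an abelian variety with complex multiplication*, J. Algebra **111** (1987)
49–73 [Dodson1987] (held text `paper:doi-10-1016-0021-8693-87-90242-0`), §4.1 "Minimal group calculations in
dimension 9", p. 67:

> PROPOSITION 4.1. Let `f ∈ ℤ₂⁹` define a type on `⟨ρ⟩ × R₀`, for `R₀` one of the two regular groups of degree `9`.
> Then the type defined by `f` is nondegenerate whenever weight(`f`) is relatively prime to `3`.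

(Proof, loc. cit.: "By the Constant Weight Criterion we are reduced to showing that the `9` elements in each orbit are
linearly independent … we pick representatives and check linear independence directly.")  Here "`f ∈ ℤ₂ⁿ` defines a
type on `⟨ρ⟩ × G₀`" is Dodson's description [Dodson1984, §3.1.1] of the CM types of a CM field `K` containing an
imaginary quadratic field `k`: `G₀ = Gal(K₀ᶜ/ℚ) ≅ Gal(Kᶜ/k)` permutes the `n` embeddings `E₀` of `K` extending a
fixed embedding of `k` (a CM type, the one INDUCED from `k`), a type `Φ` is recorded by the set `f = E₀ ∖ Φ` of
positions where it deviates from `E₀`, and weight(`f`) `= |f|`.  "`R₀` regular of degree `9`" says `K/ℚ` is abelian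
of degree `18` (`Gal(K/ℚ) = ⟨ρ⟩ × R₀`, `R₀ ∈ {ℤ₉, ℤ₃ × ℤ₃}`).

## What is proved

The constant weight criterion (tree: `IsCMTypeWith.typeRank_eq_typeRank_stabilizer_add_one`,
`cmTypeRank_eq_typeRank_stabilizer_add_one` in `Literature/…/ConstantWeightCriterionQuadraticSubfield.lean`,
[Dodson1984] §3.1.1) gives `Rank(Φ) = r + 1` with `r` the rank of the `G₀`-translates of `f` (when
`|f| ∉ {0, n/2}`).  With `CorCM/PrimePowerBlock/TranslatesSpan.lean` — the translates of a set of size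
prime to `p` under a transitive group of degree `p^j` span `ℚ^{p^j}` (`typeRank_eq_card_of_card_eq_prime_pow`: a
Sylow `p`-subgroup is transitive; the permutation module `𝔽_p^X` of a transitive `p`-group has the constants as its
socle; an integral annihilating vector reduced mod `p`) — the present file computes `r = n` whenever
`n = |E₀| = p^j` is a prime power and `p ∤ |f|`, for an ARBITRARY transitive `G₀`, so the printed case `n = 9`,
`R₀` regular (`typeRank_eq_of_ncard_eq_nine`) comes out together with every prime power and every `K₀`.  (The
mechanism is not Dodson's inspection of orbit representatives for the two regular groups of degree `9`.)

* **`typeRank_stabilizer_eq_ncard_of_prime_pow`** — Dodson's `r` equals `n` for a block `E₀` of prime-power size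
  and `p ∤ |f|` (`f ⊆ E₀`);
* **`typeRank_eq_of_prime_pow_block`** — (W)-level: `|E₀| = p^j`, `p ∤ |E₀ ∖ Φ|`, `2|E₀ ∖ Φ| ≠ p^j`
  ⟹ `Rank(Φ) = |E|/2 + 1` (NONDEGENERATE); `…_of_odd` (`p` odd: the last hypothesis is automatic);
  **`typeRank_eq_of_ncard_eq_nine`** — Prop. 4.1 as printed (`n = 9`, `3 ∤ |f|`; the hypothesis "`R₀` regular"
  of the print is not needed);
* number fields (`K` with a CM type `Φ₀` of quadratic reflex field — "`K` contains an imaginary quadratic field",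
  e.g. `Φ₀ = inducedCMType k (single ψ₀)` for `k : k₀ →+* K` —, `[K : ℚ] = 2p^m`):
  **`isNondegenerate_of_prime_pow_of_not_dvd`**, `isNondegenerate_of_prime_pow_of_not_dvd_of_odd`,
  `isNondegenerate_of_finrank_eq_eighteen` (Prop. 4.1 for every CM field of degree `18` containing an imaginary
  quadratic field), `isNondegenerate_of_prime_pow_of_ringHom(_of_odd)`.

For `j = 1` (`[K : k] = p` prime) every weight `0 < |f| < p` is prime to `p`: all types but the two induced ones are
nondegenerate — Ribet's theorem for `K ⊇ k` (tree: `typeRank_eq_of_prime`).  NOT here: the exact ranks `8`, `10`,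
`6` of the weight-`3` types in dimension `9` (Prop. 4.4), Lemma 4.2, Prop. 4.6 and Remark 4.7 of [Dodson1987] §4;
the abelian-variety reading (Hodge conjecture for all powers of the simple CM abelian `p^j`-folds of these types)
is the companion `CorCM/PrimePowerBlock/Hodge.lean`.

## References
* [Dodson1987] B. Dodson, J. Algebra 111 (1987), §4.1 Prop. 4.1 (p. 67); §2.3 Prop. 2.7 (a Sylow `p`-subgroup of
  a group of degree `p^j` is transitive, p. 62).
* [Dodson1984] B. Dodson, Trans. AMS 283 (1984), §3.1.1 Theorem (constant weight criterion).
* [Kubota1965] T. Kubota, Trans. AMS 118 (1965), §4 (rank and defect of a CM type).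
* [Gordon1999HodgeAVSurvey] B. B. Gordon, *A survey of the Hodge conjecture for abelian varieties*, §9.4.

Provenance: Literature home (namespace `Literature.NumberTheory.ComplexMultiplication.PrimePowerBlock`) of the Summits-side `CorCM/PrimePowerBlock/Nondegenerate` (cell `pub-hodgecm2`, COR-CM; all its imports are `Literature/`, Mathlib and the already re-homed `TranslatesSpan`), which `Literature/` may not import; theorems only, no named fact, no definition. Nothing here bears on `HC_CM`. Lane `lit-hodgefound` (Layer A3: CM types, their Kubota ranks and Galois combinatorics), seat p20.
-/

set_option autoImplicit false

open scoped BigOperators Pointwise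

namespace Literature.NumberTheory.ComplexMultiplication.PrimePowerBlock

open Literature.NumberTheory.ComplexMultiplication

/-! ### §4 Dodson's `r` for a block of prime-power size -/

section Block

variable {G : Type*} [Group G] {E : Type*} [MulAction G E] {ρ : G} {Φ E₀ : Set E}

/-- **Dodson's `r` is `n` for a block of prime-power size**: in the setting of the constant weight criterion (`E₀` a
CM type with `gE₀ ∈ {E₀, ρE₀}` for all `g`, `G₀ = Stab(E₀)`), if `n = |E₀| = p^j` and `f ⊆ E₀` has `p ∤ |f|`, then the
rank of the `G₀`-translates of `f` is `n` (`typeRank_eq_card_of_card_eq_prime_pow` for `G₀` acting on `E₀`, carried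
to the functions on `E` supported on `E₀` by restriction). [cite: Dodson1987, Prop. 4.1 (proof)] -/
theorem typeRank_stabilizer_eq_ncard_of_prime_pow [Fintype E] [Finite G] [MulAction.IsPretransitive G E]
    (h₀ : IsCMTypeWith ρ E₀) (hG : ∀ g : G, g • E₀ = E₀ ∨ g • E₀ = ρ • E₀) {p j : ℕ} (hp : p.Prime)
    (hE₀ : E₀.ncard = p ^ j) {f : Set E} (hfE : f ⊆ E₀) (hf : ¬ p ∣ f.ncard) :
    typeRank (MulAction.stabilizer G E₀) f = E₀.ncard := by
  classical
  set H := MulAction.stabilizer G E₀ with hH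
  haveI : MulAction.IsPretransitive H E₀ := h₀.isPretransitive_stabilizer_of_block hG
  -- the trace `f'` of `f` on the `H`-set `E₀`
  set f' : Set E₀ := Subtype.val ⁻¹' f with hf'
  have hf'c : f'.ncard = f.ncard :=
    Set.ncard_preimage_of_injective_subset_range Subtype.val_injective (by rwa [Subtype.range_coe])
  have hcard : Fintype.card E₀ = p ^ j := by rw [← Set.toFinset_card, ← Set.ncard_eq_toFinset_card', hE₀]
  have key := typeRank_eq_card_of_card_eq_prime_pow (H := H) hp hcard f' (by rwa [hf'c])
  -- restriction to `E₀`
  let R : (E → ℚ) →ₗ[ℚ] (E₀ → ℚ) := LinearMap.funLeft ℚ ℚ (Subtype.val : E₀ → E)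
  have hR : ∀ m : H, R (translateInd f m) = translateInd f' m := fun m => by
    funext x
    change translateInd f m (x : E) = translateInd f' m x
    by_cases hx : m • (x : E) ∈ f
    · rw [translateInd_of_mem hx, translateInd_of_mem (show m • x ∈ f' from hx)]
    · rw [translateInd_of_not_mem hx, translateInd_of_not_mem (show m • x ∉ f' from hx)]
  set W := Submodule.span ℚ (Set.range fun m : H => translateInd f m) with hW
  have hmap : W.map R = Submodule.span ℚ (Set.range fun m : H => translateInd f' m) := by
    rw [hW, Submodule.map_span, ← Set.range_comp]
    exact congrArg (fun s : H → (E₀ → ℚ) => Submodule.span ℚ (Set.range s)) (funext fun m => hR m)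
  have htf : typeRank H f = Module.finrank ℚ W := rfl
  have htf' : Module.finrank ℚ (W.map R) = typeRank H f' := by rw [hmap]; rfl
  apply le_antisymm
  · -- `R` is injective on `W`, whose members vanish off `E₀`
    have hWE : ∀ u ∈ W, ∀ x : E, x ∉ E₀ → u x = 0 := by
      intro u hu x hx
      induction hu using Submodule.span_induction with
      | mem u hu' =>
        obtain ⟨m, rfl⟩ := hu'
        refine translateInd_of_not_mem fun hm => hx ?_
        have hmE : (m : G) • E₀ = E₀ := m.2
        have h1 : (m : G) • x ∈ (m : G) • E₀ := by rw [hmE]; exact hfE hm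
        exact Set.smul_mem_smul_set_iff.1 h1
      | zero => rfl
      | add u u' _ _ hu hu' => rw [Pi.add_apply, hu, hu', add_zero]
      | smul c u _ hu => rw [Pi.smul_apply, hu, smul_zero]
    have hinj : Function.Injective (R.domRestrict W) := by
      intro u u' huu'
      apply Subtype.ext
      funext x
      by_cases hx : x ∈ E₀
      · exact congrFun huu' ⟨x, hx⟩
      · rw [hWE u u.2 x hx, hWE u' u'.2 x hx]
    calc typeRank H f = Module.finrank ℚ W := htf
      _ = Module.finrank ℚ (LinearMap.range (R.domRestrict W)) := (LinearMap.finrank_range_of_inj hinj).symm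
      _ ≤ Module.finrank ℚ (E₀ → ℚ) := Submodule.finrank_le _
      _ = Fintype.card E₀ := Module.finrank_fintype_fun_eq_card ℚ
      _ = E₀.ncard := by rw [hcard, hE₀]
  · calc E₀.ncard = Fintype.card E₀ := by rw [hcard, hE₀]
      _ = typeRank H f' := key.symm
      _ = Module.finrank ℚ (W.map R) := htf'.symm
      _ ≤ Module.finrank ℚ W := Submodule.finrank_map_le R W
      _ = typeRank H f := htf.symm

/-! ### §5 Nondegeneracy: weight prime to `p` over a block of size `p^j` -/

/-- **Weight prime to `p` over a block of prime-power size ⟹ NONDEGENERATE.**  In the setting (W) of the constant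
weight criterion — `Φ` a CM type for `ρ`, `E₀` a CM type with `gE₀ ∈ {E₀, ρE₀}` for every `g` ("`K` contains an
imaginary quadratic field"), `G` transitive —: if `n = |E₀| = p^j`, the weight `w = |E₀ ∖ Φ|` is prime to `p`, and
`2w ≠ n`, then `Rank(Φ) = |E|/2 + 1`.  Printed for `n = 9`, `G₀` regular [Dodson1987, Prop. 4.1]; the proof here
(`r = n` by `typeRank_stabilizer_eq_ncard_of_prime_pow`, then `Rank = r + 1`) covers every prime power and every
transitive `G₀`. [cite: Dodson1987, Prop. 4.1] [cite: Dodson1984, §3.1.1 Theorem] -/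
theorem typeRank_eq_of_prime_pow_block [Fintype E] [Nonempty E] [Finite G] [MulAction.IsPretransitive G E]
    (h : IsCMTypeWith ρ Φ) (h₀ : IsCMTypeWith ρ E₀) (hG : ∀ g : G, g • E₀ = E₀ ∨ g • E₀ = ρ • E₀)
    {p j : ℕ} (hp : p.Prime) (hE₀ : E₀.ncard = p ^ j) (hf : ¬ p ∣ (E₀ \ Φ).ncard)
    (h2 : 2 * (E₀ \ Φ).ncard ≠ E₀.ncard) : typeRank G Φ = Fintype.card E / 2 + 1 := by
  have hw0 : ¬ E₀ ⊆ Φ := fun hsub => hf (by rw [Set.sdiff_eq_empty.2 hsub, Set.ncard_empty]; exact dvd_zero p)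
  rw [h.typeRank_eq_typeRank_stabilizer_add_one h₀ hG h2 hw0,
    typeRank_stabilizer_eq_ncard_of_prime_pow h₀ hG hp hE₀ Set.sdiff_subset hf]
  have hE : 2 * E₀.ncard = Fintype.card E := by
    rw [← Nat.card_eq_fintype_card]; exact two_mul_ncard_eq_card_of_cm h₀.mem_iff
  omega

/-- **`p` odd**: the side condition `2|E₀ ∖ Φ| ≠ p^j` is automatic, so EVERY type whose weight over the block is
prime to `p` is nondegenerate. [cite: Dodson1987, Prop. 4.1] -/
theorem typeRank_eq_of_prime_pow_block_of_odd [Fintype E] [Nonempty E] [Finite G]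
    [MulAction.IsPretransitive G E] (h : IsCMTypeWith ρ Φ) (h₀ : IsCMTypeWith ρ E₀)
    (hG : ∀ g : G, g • E₀ = E₀ ∨ g • E₀ = ρ • E₀) {p j : ℕ} (hp : p.Prime) (hp2 : p ≠ 2)
    (hE₀ : E₀.ncard = p ^ j) (hf : ¬ p ∣ (E₀ \ Φ).ncard) : typeRank G Φ = Fintype.card E / 2 + 1 :=
  typeRank_eq_of_prime_pow_block h h₀ hG hp hE₀ hf fun h2 => by
    have hodd : Odd (p ^ j) := (hp.odd_of_ne_two hp2).pow
    rw [← hE₀, ← h2] at hodd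
    exact Nat.not_even_iff_odd.2 hodd (even_two_mul _)

/-- **Dodson 1987, Proposition 4.1** (`n = 9`): "Let `f ∈ ℤ₂⁹` define a type on `⟨ρ⟩ × R₀`, for `R₀` one of the two
regular groups of degree `9`.  Then the type defined by `f` is nondegenerate whenever weight(`f`) is relatively
prime to `3`."  Here: a block `E₀` of `9` embeddings (`[K : k] = 9`) and `3 ∤ |E₀ ∖ Φ|` give `Rank(Φ) = |E|/2 + 1`;
the regularity of `R₀ = G₀` assumed in print is not used. [cite: Dodson1987, Prop. 4.1] -/
theorem typeRank_eq_of_ncard_eq_nine [Fintype E] [Nonempty E] [Finite G] [MulAction.IsPretransitive G E]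
    (h : IsCMTypeWith ρ Φ) (h₀ : IsCMTypeWith ρ E₀) (hG : ∀ g : G, g • E₀ = E₀ ∨ g • E₀ = ρ • E₀)
    (hE₀ : E₀.ncard = 9) (hf : ¬ 3 ∣ (E₀ \ Φ).ncard) : typeRank G Φ = Fintype.card E / 2 + 1 :=
  typeRank_eq_of_prime_pow_block_of_odd h h₀ hG Nat.prime_three (by norm_num) (j := 2) (by rw [hE₀]; norm_num) hf

end Block

/-! ### §6 Number fields: CM fields of degree `2p^j` containing an imaginary quadratic field -/

section NumberField

open NumberField
open Literature.AlgebraicGeometry.Motives (CMType)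
open Literature.AlgebraicGeometry.Pohlmann1968 (cmTypeRank IsNondegenerate)

variable {K : Type} [Field K] [NumberField K]
variable {L : Type} [Field L] [NumberField L] [IsCMField L] [IsGalois ℚ L]

/-- **Weight prime to `p` ⟹ NONDEGENERATE, for a CM field of degree `2p^j` containing an imaginary quadratic
field.**  `K` a number field with complex CM types, `L/ℚ` Galois CM receiving `K` (`j : K →ₐ[ℚ] L`), `Φ₀` a CM type
of `K` whose reflex field is quadratic (the type induced from an imaginary quadratic subfield `k`), `[K : ℚ] = 2p^m`.
If the weight `w = |Φ₀ ∖ Φ|` of `Φ` over `Φ₀` is prime to `p` and `2w ≠ p^m`, then `Φ` is nondegenerate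
(`Rank(Φ) = [K:ℚ]/2 + 1`).  Printed for `[K : ℚ] = 18` and `K/ℚ` abelian [Dodson1987, Prop. 4.1].
[cite: Dodson1987, Prop. 4.1] [cite: Dodson1984, §3.1.1 Theorem] -/
theorem isNondegenerate_of_prime_pow_of_not_dvd (j : K →ₐ[ℚ] L) (ι : L →+* ℂ) (Φ₀ Φ : CMType K)
    (h2 : Module.finrank ℚ (reflexField ℚ L (algValuedIn ι Φ₀.1)) = 2) {p m : ℕ} (hp : p.Prime)
    (hK : Module.finrank ℚ K = 2 * p ^ m) (hf : ¬ p ∣ (Φ₀.1 \ Φ.1).ncard)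
    (hw : 2 * (Φ₀.1 \ Φ.1).ncard ≠ p ^ m) : IsNondegenerate Φ := by
  haveI : Nonempty (K →ₐ[ℚ] L) := ⟨j⟩
  have h₀ := isCMTypeWith_conjGal_algValuedIn ι Φ₀
  have h := isCMTypeWith_conjGal_algValuedIn ι Φ
  have hG := smul_algValuedIn_eq_or_of_finrank_reflexField_eq_two j ι Φ₀ h2
  have hn : (algValuedIn ι Φ₀.1).ncard = p ^ m := by
    rw [ncard_algValuedIn j ι, ncard_cmType_eq, hK]; omega
  have hsd : algValuedIn ι Φ₀.1 \ algValuedIn ι Φ.1 = algValuedIn ι (Φ₀.1 \ Φ.1) := rfl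
  rw [isNondegenerate_iff_typeRank_algValuedIn j ι Φ]
  exact typeRank_eq_of_prime_pow_block h h₀ hG hp hn (by rw [hsd, ncard_algValuedIn j ι]; exact hf)
    (by rw [hsd, ncard_algValuedIn j ι, hn]; exact hw)

/-- **`p` odd: weight prime to `p` ⟹ nondegenerate** (`[K : ℚ] = 2p^m`, no side condition).
[cite: Dodson1987, Prop. 4.1] -/
theorem isNondegenerate_of_prime_pow_of_not_dvd_of_odd (j : K →ₐ[ℚ] L) (ι : L →+* ℂ) (Φ₀ Φ : CMType K)
    (h2 : Module.finrank ℚ (reflexField ℚ L (algValuedIn ι Φ₀.1)) = 2) {p m : ℕ} (hp : p.Prime) (hp2 : p ≠ 2)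
    (hK : Module.finrank ℚ K = 2 * p ^ m) (hf : ¬ p ∣ (Φ₀.1 \ Φ.1).ncard) : IsNondegenerate Φ :=
  isNondegenerate_of_prime_pow_of_not_dvd j ι Φ₀ Φ h2 hp hK hf fun hw => by
    have hodd : Odd (p ^ m) := (hp.odd_of_ne_two hp2).pow
    rw [← hw] at hodd
    exact Nat.not_even_iff_odd.2 hodd (even_two_mul _)

/-- **Dodson 1987, Prop. 4.1 for every CM field of degree `18` containing an imaginary quadratic field**: a CM type
whose weight over the induced type `Φ₀` is prime to `3` (i.e. `w ∈ {1, 2, 4, 5, 7, 8}`) is nondegenerate — for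
`K/ℚ` abelian (`Gal = ⟨ρ⟩ × ℤ₉` or `⟨ρ⟩ × ℤ₃²`) this is the printed statement. [cite: Dodson1987, Prop. 4.1] -/
theorem isNondegenerate_of_finrank_eq_eighteen (j : K →ₐ[ℚ] L) (ι : L →+* ℂ) (Φ₀ Φ : CMType K)
    (h2 : Module.finrank ℚ (reflexField ℚ L (algValuedIn ι Φ₀.1)) = 2) (hK : Module.finrank ℚ K = 18)
    (hf : ¬ 3 ∣ (Φ₀.1 \ Φ.1).ncard) : IsNondegenerate Φ :=
  isNondegenerate_of_prime_pow_of_not_dvd_of_odd j ι Φ₀ Φ h2 Nat.prime_three (by norm_num) (m := 2)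
    (by norm_num [hK]) hf

/-! ### Over an explicit imaginary quadratic subfield `k : k₀ →+* K` -/

section ImaginaryQuadratic

variable {k₀ : Type} [Field k₀] [NumberField k₀] [IsTotallyComplex k₀]

omit [NumberField K] in
/-- The weight over `ψ₀`: `Φ₀ ∖ Φ = {φ ∉ Φ | φ ∘ k = ψ₀}` for the block `Φ₀` induced from `(k₀, {ψ₀})`.
[cite: Dodson1984, §3.1.1 Theorem] -/
private theorem inducedCMType_single_diff (hk2 : Module.finrank ℚ k₀ = 2) (k : k₀ →+* K) (ψ₀ : k₀ →+* ℂ)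
    (Φ : CMType K) :
    (inducedCMType k (CMTypeCount.single hk2 ψ₀)).1 \ Φ.1 = {φ : K →+* ℂ | φ ∉ Φ.1 ∧ φ.comp k = ψ₀} := by
  ext φ
  simp only [Set.mem_sdiff, mem_inducedCMType_iff, CMTypeCount.single_val, Set.mem_singleton_iff,
    Set.mem_setOf_eq]
  tauto

/-- **`K ⊇ k` with `[K : k] = p^m`: weight prime to `p` (and `≠ p^m/2`) ⟹ nondegenerate**, the weight of `Φ` over
the embedding `ψ₀` of the imaginary quadratic field `k₀` being `|{φ ∉ Φ | φ ∘ k = ψ₀}|`.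
[cite: Dodson1987, Prop. 4.1] [cite: Dodson1984, §3.1.1 Theorem] -/
theorem isNondegenerate_of_prime_pow_of_ringHom (hk2 : Module.finrank ℚ k₀ = 2) (k : k₀ →+* K)
    (j : K →ₐ[ℚ] L) (ι : L →+* ℂ) (ψ₀ : k₀ →+* ℂ) (Φ : CMType K) {p m : ℕ} (hp : p.Prime)
    (hK : Module.finrank ℚ K = 2 * p ^ m) (hf : ¬ p ∣ {φ : K →+* ℂ | φ ∉ Φ.1 ∧ φ.comp k = ψ₀}.ncard)
    (hw : 2 * {φ : K →+* ℂ | φ ∉ Φ.1 ∧ φ.comp k = ψ₀}.ncard ≠ p ^ m) : IsNondegenerate Φ := by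
  rw [← inducedCMType_single_diff hk2 k ψ₀ Φ] at hf hw
  exact isNondegenerate_of_prime_pow_of_not_dvd j ι _ Φ
    (finrank_reflexField_algValuedIn_inducedCMType_single hk2 k j ι ψ₀) hp hK hf hw

/-- **`K ⊇ k` with `[K : k] = p^m`, `p` odd: weight prime to `p` ⟹ nondegenerate.** [cite: Dodson1987, Prop. 4.1] -/
theorem isNondegenerate_of_prime_pow_of_ringHom_of_odd (hk2 : Module.finrank ℚ k₀ = 2) (k : k₀ →+* K)
    (j : K →ₐ[ℚ] L) (ι : L →+* ℂ) (ψ₀ : k₀ →+* ℂ) (Φ : CMType K) {p m : ℕ} (hp : p.Prime) (hp2 : p ≠ 2)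
    (hK : Module.finrank ℚ K = 2 * p ^ m) (hf : ¬ p ∣ {φ : K →+* ℂ | φ ∉ Φ.1 ∧ φ.comp k = ψ₀}.ncard) :
    IsNondegenerate Φ := by
  rw [← inducedCMType_single_diff hk2 k ψ₀ Φ] at hf
  exact isNondegenerate_of_prime_pow_of_not_dvd_of_odd j ι _ Φ
    (finrank_reflexField_algValuedIn_inducedCMType_single hk2 k j ι ψ₀) hp hp2 hK hf

end ImaginaryQuadratic

end NumberField

end Literature.NumberTheory.ComplexMultiplication.PrimePowerBlock
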